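import Mathlib

/-!
# `MatrixDescartes` census — the m = 2 pivot law: LEMMA W (fixed dual weights), polynomial core

HONEST FRAMING.  Object-search cell `pub-symmetroid`, crux `Theses.LacunarySymmetroid.MatrixDescartes`
(stmt-ValiantsHypothesis-18050); seat val-sym-mdr-p1 (g8), continuing g7's pivot-law programme (memo `HOME/val-sym-mdr-p1/g7/ENVELOPE-AND-CORE.md`
§2bis).  A self-contained real-polynomial lemma and its rational-sum form; it proves NOTHING about the crux `MatrixDescartes`, the `(2,K)` pivot law
itself, `DoorA26` / `DoorA34`, or `VP ≠ VNP`.  No definitions; Mathlib only.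

LEMMA W (g7, paper): for weights `w_k > 0`, centres and parameters `γ_k ∈ (−1,1)` the function `F(z) = ∑ w_k σ_{γ_k}(z − z_k)`,
`σ_γ(s) = sinh s / (cosh s − γ)`, has at most `2K − 1` real zeros.  With `X = e^z`, `a_k = e^{z_k}` one has
`σ_{γ_k}(z − z_k) = (X² − a_k²)/Q_k(X)`, `Q_k = X² − 2γ_k a_k X + a_k² > 0`, so `F = N/∏ Q_k` with `N = ∑ w_k (X² − a_k²) ∏_{j≠k} Q_j` of
degree `2K`, leading coefficient `∑ w_k > 0` and `N(0) = −(∏ a_j²)(∑ w_k) < 0`.  THIS FILE proves the polynomial heart: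
* `card_posRoots_le_of_eval_zero_neg`: a real polynomial of EVEN degree `d` with positive leading coefficient and NEGATIVE value at `0` has at
  most `d − 1` distinct positive roots (if it had `d`, it would split with all roots positive and simple, forcing `N(0) = lc · ∏(−r) > 0`);
* `lemmaW_numerator`: degree, leading coefficient and constant term of `N` as above (`a_k ≠ 0`, `w_k > 0`, any `γ_k`);
* `lemmaW_rational`: hence at most `2K − 1` points `X > 0` with `∑ w_k (X² − a_k²)/Q_k(X) = 0`, whenever every `Q_k > 0` on `(0,∞)`
  (e.g. `|γ_k| < 1`) — the zeros of `F` in the variable `X = e^z`.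
[folklore] (elementary; the `sinh/cosh` dressing and the duality use of the lemma stay on paper, memo §2bis).
-/

-- `Summit.ValiantsHypothesis.ValiantsHypothesis.…` repeats a component by the D-0017 layout
-- (single-conjunct summit), which the `dupNamespace` linter flags; the name is mandated.
set_option linter.dupNamespace false

namespace Summit.ValiantsHypothesis.ValiantsHypothesis.Theorems.LacunarySymmetroidMatrixDescartes.Pivot.LemmaW

open Polynomial Finset
open scoped BigOperators

/-- **Even degree, negative at `0`, positive leading coefficient ⇒ at most `deg − 1` distinct positive roots.**  If a real polynomial
`N` of even natural degree `d` with `0 < lc N` and `N(0) < 0` had `d` distinct positive roots, it would split over `ℝ` with all roots positive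
(`Polynomial.C_leadingCoeff_mul_prod_multiset_X_sub_C`), whence `N(0) = lc · (−1)^d ∏ r > 0`. [folklore] -/
theorem card_posRoots_le_of_eval_zero_neg (N : ℝ[X]) {d : ℕ} (hd : N.natDegree = d) (heven : Even d)
    (hlc : 0 < N.leadingCoeff) (h0 : N.eval 0 < 0) :
    (N.roots.toFinset.filter (fun r => 0 < r)).card ≤ d - 1 := by
  classical
  have hN : N ≠ 0 := fun h => by rw [h, leadingCoeff_zero] at hlc; exact lt_irrefl 0 hlc
  by_contra hlt
  have hge : d ≤ (N.roots.toFinset.filter (fun r => 0 < r)).card := by omega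
  -- the chain `#filter ≤ #toFinset ≤ card roots ≤ natDegree = d`
  have h1 : (N.roots.toFinset.filter (fun r => 0 < r)).card ≤ N.roots.toFinset.card := card_filter_le _ _
  have h2 : N.roots.toFinset.card ≤ Multiset.card N.roots := Multiset.toFinset_card_le _
  have h3 : Multiset.card N.roots ≤ d := hd ▸ card_roots' N
  have hcard : Multiset.card N.roots = N.natDegree := by rw [hd]; omega
  have h4 : (N.roots.toFinset.filter (fun r => 0 < r)).card = N.roots.toFinset.card := by omega
  have hall : ∀ r ∈ N.roots.toFinset, 0 < r := (card_filter_eq_iff (p := fun r : ℝ => 0 < r)).mp h4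
  have hpos : ∀ r ∈ N.roots, 0 < r := fun r hr => hall r (Multiset.mem_toFinset.mpr hr)
  -- split form and evaluation at `0`
  have hsplit := C_leadingCoeff_mul_prod_multiset_X_sub_C hcard
  have heval : N.eval 0 = N.leadingCoeff * ((-1) ^ Multiset.card N.roots * (N.roots.map id).prod) := by
    conv_lhs => rw [← hsplit]
    rw [eval_mul, eval_C, eval_multiset_prod, Multiset.map_map]
    have hfun : (eval (0 : ℝ) ∘ fun a : ℝ => X - C a) = Neg.neg := by
      funext a; simp
    rw [hfun, Multiset.prod_map_neg, Multiset.map_id]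
  have hprod : 0 < (N.roots.map id).prod := by
    rw [Multiset.map_id]; exact Multiset.prod_pos hpos
  have hevend : Even (Multiset.card N.roots) := by rw [hcard, hd]; exact heven
  rw [hevend.neg_one_pow, one_mul] at heval
  have : 0 < N.eval 0 := by rw [heval]; exact mul_pos hlc hprod
  linarith

/-- The quadratic `Q = X² − C b · X + C c` is monic of degree `2`. [folklore] -/
theorem monic_quad (b c : ℝ) : (X ^ 2 - C b * X + C c : ℝ[X]).Monic ∧ (X ^ 2 - C b * X + C c : ℝ[X]).natDegree = 2 := by
  have hq : (X ^ 2 - C b * X + C c : ℝ[X]) = X ^ 2 + (C (-b) * X + C c) := by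
    simp only [map_neg, neg_mul]; ring
  have hdeg : (C (-b) * X + C c : ℝ[X]).degree < (X ^ 2 : ℝ[X]).degree := by
    rw [degree_X_pow]
    refine lt_of_le_of_lt (degree_add_le _ _) (max_lt ?_ ?_)
    · exact lt_of_le_of_lt (degree_C_mul_X_le _) (by exact_mod_cast one_lt_two)
    · exact lt_of_le_of_lt degree_C_le (by exact_mod_cast two_pos)
  have hmonic : (X ^ 2 - C b * X + C c : ℝ[X]).Monic := by
    rw [hq]; exact (monic_X_pow 2).add_of_left hdeg
  refine ⟨hmonic, ?_⟩
  rw [hq]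
  have h := natDegree_add_eq_left_of_degree_lt hdeg
  rw [h, natDegree_X_pow]

/-- **The numerator of LEMMA W.**  For `w_k`, `a_k`, `b_k : ℝ` (`k < K`) put `Q_j = X² − C b_j · X + C (a_j²)` and
`N = ∑_k C w_k · (X² − C (a_k²)) · ∏_{j ≠ k} Q_j`.  Then `deg N ≤ 2K`, `coeff N (2K) = ∑ w_k` and `N(0) = −(∑ w_k) · ∏ a_j²`. [folklore] -/
theorem lemmaW_numerator {K : ℕ} (w a b : Fin K → ℝ) :
    let Q : Fin K → ℝ[X] := fun j => X ^ 2 - C (b j) * X + C (a j ^ 2)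
    let N : ℝ[X] := ∑ k, C (w k) * (X ^ 2 - C (a k ^ 2)) * ∏ j ∈ univ.erase k, Q j
    N.natDegree ≤ 2 * K ∧ N.coeff (2 * K) = ∑ k, w k ∧ N.eval 0 = -(∑ k, w k) * ∏ j, a j ^ 2 := by
  classical
  intro Q N
  -- each summand: `C w_k * M_k` with `M_k` monic of degree `2K`
  have hQ : ∀ j, (Q j).Monic ∧ (Q j).natDegree = 2 := fun j => monic_quad (b j) (a j ^ 2)
  have hP : ∀ k : Fin K, (X ^ 2 - C (a k ^ 2) : ℝ[X]).Monic ∧ (X ^ 2 - C (a k ^ 2) : ℝ[X]).natDegree = 2 := fun k => by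
    have h := monic_quad 0 (-(a k ^ 2))
    simp only [map_zero, zero_mul, sub_zero, map_neg] at h
    rw [sub_eq_add_neg]
    exact h
  have hM : ∀ k : Fin K, ((X ^ 2 - C (a k ^ 2)) * ∏ j ∈ univ.erase k, Q j).Monic ∧
      ((X ^ 2 - C (a k ^ 2)) * ∏ j ∈ univ.erase k, Q j).natDegree = 2 * K := by
    intro k
    have hprodm : (∏ j ∈ univ.erase k, Q j).Monic := monic_prod_of_monic _ _ fun j _ => (hQ j).1
    have hprodd : (∏ j ∈ univ.erase k, Q j).natDegree = 2 * (K - 1) := by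
      rw [natDegree_prod_of_monic _ _ fun j _ => (hQ j).1]
      simp only [(hQ _).2, sum_const, smul_eq_mul, card_erase_of_mem (mem_univ k), card_univ, Fintype.card_fin]
      ring
    refine ⟨(hP k).1.mul hprodm, ?_⟩
    rw [(hP k).1.natDegree_mul hprodm, (hP k).2, hprodd]
    have : 1 ≤ K := Nat.succ_le_of_lt (Fin.pos k)
    omega
  -- degree bound
  have hdeg : N.natDegree ≤ 2 * K := by
    refine natDegree_sum_le_of_forall_le _ _ fun k _ => ?_
    calc (C (w k) * (X ^ 2 - C (a k ^ 2)) * ∏ j ∈ univ.erase k, Q j).natDegree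
        = (C (w k) * ((X ^ 2 - C (a k ^ 2)) * ∏ j ∈ univ.erase k, Q j)).natDegree := by rw [mul_assoc]
      _ ≤ ((X ^ 2 - C (a k ^ 2)) * ∏ j ∈ univ.erase k, Q j).natDegree := natDegree_C_mul_le _ _
      _ = 2 * K := (hM k).2
  -- top coefficient
  have hcoeff : N.coeff (2 * K) = ∑ k, w k := by
    show (∑ k, C (w k) * (X ^ 2 - C (a k ^ 2)) * ∏ j ∈ univ.erase k, Q j).coeff (2 * K) = ∑ k, w k
    rw [finsetSum_coeff]
    refine sum_congr rfl fun k _ => ?_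
    rw [mul_assoc, coeff_C_mul]
    have hlc : ((X ^ 2 - C (a k ^ 2)) * ∏ j ∈ univ.erase k, Q j).coeff (2 * K) = 1 := by
      rw [← (hM k).2]
      exact (hM k).1
    rw [hlc, mul_one]
  -- value at `0`
  have heval : N.eval 0 = -(∑ k, w k) * ∏ j, a j ^ 2 := by
    show (∑ k, C (w k) * (X ^ 2 - C (a k ^ 2)) * ∏ j ∈ univ.erase k, Q j).eval 0 = -(∑ k, w k) * ∏ j, a j ^ 2
    rw [eval_finsetSum]
    have hterm : ∀ k : Fin K, (C (w k) * (X ^ 2 - C (a k ^ 2)) * ∏ j ∈ univ.erase k, Q j).eval 0 = -(w k * ∏ j, a j ^ 2) := by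
      intro k
      rw [eval_mul, eval_mul, eval_prod, eval_C]
      have hq0 : ∀ j, (Q j).eval 0 = a j ^ 2 := fun j => by
        show (X ^ 2 - C (b j) * X + C (a j ^ 2) : ℝ[X]).eval 0 = a j ^ 2
        simp
      simp only [hq0, eval_sub, eval_pow, eval_X, eval_C, ne_eq, OfNat.ofNat_ne_zero, not_false_eq_true, zero_pow,
        zero_sub]
      rw [← mul_prod_erase univ (fun j => a j ^ 2) (mem_univ k)]
      ring
    simp only [hterm, sum_neg_distrib, ← sum_mul]
    ring
  exact ⟨hdeg, hcoeff, heval⟩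

/-- **LEMMA W, rational form (kernel core).**  For `K ≥ 1`, positive weights `w_k`, nonzero `a_k` and any `b_k` such that every
`Q_k(X) = X² − b_k X + a_k²` is positive on `(0,∞)` (e.g. `b_k = 2γ_k a_k` with `|γ_k| < 1`), the positive solutions `X` of
`∑_k w_k (X² − a_k²)/Q_k(X) = 0` number at most `2K − 1`: they are positive roots of the numerator `N` of `lemmaW_numerator`, which has even
degree `2K`, leading coefficient `∑ w_k > 0` and `N(0) < 0` (`card_posRoots_le_of_eval_zero_neg`).  In g7's variables `X = e^z`, `a_k = e^{z_k}`
this is «`∑ w_k σ_{γ_k}(z − z_k)` has at most `2K − 1` zeros». [folklore] -/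
theorem lemmaW_rational {K : ℕ} (hK : 1 ≤ K) (w a b : Fin K → ℝ) (hw : ∀ k, 0 < w k) (ha : ∀ k, a k ≠ 0)
    (hQpos : ∀ k, ∀ x : ℝ, 0 < x → 0 < x ^ 2 - b k * x + a k ^ 2) (s : Finset ℝ) (hs0 : ∀ x ∈ s, 0 < x)
    (hs : ∀ x ∈ s, ∑ k, w k * (x ^ 2 - a k ^ 2) / (x ^ 2 - b k * x + a k ^ 2) = 0) :
    s.card ≤ 2 * K - 1 := by
  classical
  obtain ⟨hdeg, hcoeff, heval⟩ := lemmaW_numerator w a b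
  set Q : Fin K → ℝ[X] := fun j => X ^ 2 - C (b j) * X + C (a j ^ 2) with hQdef
  set N : ℝ[X] := ∑ k, C (w k) * (X ^ 2 - C (a k ^ 2)) * ∏ j ∈ univ.erase k, Q j with hNdef
  have hwsum : 0 < ∑ k, w k := by
    have : (univ : Finset (Fin K)).Nonempty := ⟨⟨0, hK⟩, mem_univ _⟩
    exact sum_pos (fun k _ => hw k) this
  -- exact degree and leading coefficient
  have hnat : N.natDegree = 2 * K := by
    refine le_antisymm hdeg (le_natDegree_of_ne_zero ?_)
    rw [hcoeff]; exact hwsum.ne'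
  have hlc : 0 < N.leadingCoeff := by
    rw [leadingCoeff, hnat, hcoeff]; exact hwsum
  have h0 : N.eval 0 < 0 := by
    rw [heval, neg_mul]
    exact neg_neg_of_pos (mul_pos hwsum (prod_pos fun j _ => sq_pos_iff.mpr (ha j)))
  -- every point of `s` is a positive root of `N`
  have hroot : ∀ x ∈ s, x ∈ N.roots.toFinset.filter (fun r => 0 < r) := by
    intro x hx
    have hN0 : N ≠ 0 := fun h => by rw [h, leadingCoeff_zero] at hlc; exact lt_irrefl 0 hlc
    rw [mem_filter, Multiset.mem_toFinset, mem_roots hN0, IsRoot.def]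
    refine ⟨?_, hs0 x hx⟩
    -- `N(x) = (∏ Q_j(x)) · ∑ w_k (x² − a_k²)/Q_k(x) = 0`
    have hQx : ∀ j, (Q j).eval x = x ^ 2 - b j * x + a j ^ 2 := fun j => by
      show (X ^ 2 - C (b j) * X + C (a j ^ 2) : ℝ[X]).eval x = _; simp
    have hQne : ∀ j, x ^ 2 - b j * x + a j ^ 2 ≠ 0 := fun j => (hQpos j x (hs0 x hx)).ne'
    have hterm : ∀ k : Fin K, (C (w k) * (X ^ 2 - C (a k ^ 2)) * ∏ j ∈ univ.erase k, Q j).eval x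
        = (∏ j, (x ^ 2 - b j * x + a j ^ 2)) * (w k * (x ^ 2 - a k ^ 2) / (x ^ 2 - b k * x + a k ^ 2)) := by
      intro k
      rw [eval_mul, eval_mul, eval_prod, eval_C]
      have h1 : ((X ^ 2 - C (a k ^ 2) : ℝ[X])).eval x = x ^ 2 - a k ^ 2 := by simp
      rw [h1, Finset.prod_congr rfl (fun j _ => hQx j),
        ← mul_prod_erase univ (fun j => x ^ 2 - b j * x + a j ^ 2) (mem_univ k)]
      have hk := hQne k
      rw [mul_div_assoc', eq_comm, div_eq_iff hk]
      ring
    show (∑ k, C (w k) * (X ^ 2 - C (a k ^ 2)) * ∏ j ∈ univ.erase k, Q j).eval x = 0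
    rw [eval_finsetSum]
    simp only [hterm, ← mul_sum, hs x hx, mul_zero]
  calc s.card ≤ (N.roots.toFinset.filter (fun r => 0 < r)).card := card_le_card fun x hx => hroot x hx
    _ ≤ 2 * K - 1 := card_posRoots_le_of_eval_zero_neg N hnat (even_two_mul K) hlc h0

/-- **LEMMA W (g7, memo §2bis) in the kernel.**  For `K ≥ 1`, positive weights `w_k`, centres `c_k` and parameters `|γ_k| < 1`, the
function `z ↦ ∑_k w_k · sinh(z − c_k)/(cosh(z − c_k) − γ_k)` has at most `2K − 1` real zeros: every finite set of zeros has at most `2K − 1`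
elements (substitute `X = e^z`, `a_k = e^{c_k}`, `b_k = 2γ_k a_k` in `lemmaW_rational`; `cosh − γ_k > 0` since `|γ_k| < 1`).  Equivalently every
fixed-dual-weight potential `ψ_w(z) = ∑ w_k log(cosh(z − c_k) − γ_k)` has at most `K` local minima.  Nothing about the `(2,K)` pivot law itself
is claimed. [folklore] -/
theorem lemmaW {K : ℕ} (hK : 1 ≤ K) (w c γ : Fin K → ℝ) (hw : ∀ k, 0 < w k) (hγ : ∀ k, |γ k| < 1)
    (s : Finset ℝ) (hs : ∀ z ∈ s, ∑ k, w k * (Real.sinh (z - c k) / (Real.cosh (z - c k) - γ k)) = 0) :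
    s.card ≤ 2 * K - 1 := by
  classical
  set a : Fin K → ℝ := fun k => Real.exp (c k) with ha_def
  set b : Fin K → ℝ := fun k => 2 * γ k * Real.exp (c k) with hb_def
  have ha : ∀ k, a k ≠ 0 := fun k => (Real.exp_pos _).ne'
  have hQpos : ∀ k, ∀ x : ℝ, 0 < x → 0 < x ^ 2 - b k * x + a k ^ 2 := by
    intro k x _
    have hγ' := abs_lt.mp (hγ k)
    have hA : 0 < a k := Real.exp_pos _
    have h1 : 0 < (1 - γ k ^ 2) * a k ^ 2 := mul_pos (by nlinarith) (pow_pos hA 2)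
    have hb : b k = 2 * γ k * a k := rfl
    rw [hb]
    nlinarith [sq_nonneg (x - γ k * a k)]
  -- the substitution `X = e^z`: `sinh(z − c)/(cosh(z − c) − γ) = (X² − a²)/(X² − 2γaX + a²)`
  have hid : ∀ z : ℝ, ∀ k, Real.sinh (z - c k) / (Real.cosh (z - c k) - γ k)
      = (Real.exp z ^ 2 - a k ^ 2) / (Real.exp z ^ 2 - b k * Real.exp z + a k ^ 2) := by
    intro z k
    have hX : 0 < Real.exp z := Real.exp_pos z
    have hA : 0 < a k := Real.exp_pos _
    have hXne := hX.ne'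
    have hAne := hA.ne'
    have hexp : Real.exp (z - c k) = Real.exp z / a k := by rw [Real.exp_sub]
    have hexpn : Real.exp (-(z - c k)) = a k / Real.exp z := by
      rw [Real.exp_neg, hexp, inv_div]
    have hsinh : Real.sinh (z - c k) = (Real.exp z ^ 2 - a k ^ 2) / (2 * a k * Real.exp z) := by
      rw [Real.sinh_eq, hexp, hexpn]
      field_simp
    have hcosh : Real.cosh (z - c k) - γ k = (Real.exp z ^ 2 - b k * Real.exp z + a k ^ 2) / (2 * a k * Real.exp z) := by
      rw [Real.cosh_eq, hexp, hexpn]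
      have hb : b k = 2 * γ k * a k := rfl
      rw [hb]
      field_simp
      ring
    have hD : Real.exp z ^ 2 - b k * Real.exp z + a k ^ 2 ≠ 0 := (hQpos k _ hX).ne'
    have h2 : (2 * a k * Real.exp z) ≠ 0 := by positivity
    rw [hsinh, hcosh, div_div_div_cancel_right₀ h2]
  -- transfer to the rational form on `s.image exp`
  have hcard : (s.image Real.exp).card = s.card := Finset.card_image_of_injective _ Real.exp_injective
  rw [← hcard]
  refine lemmaW_rational hK w a b hw ha hQpos (s.image Real.exp) ?_ ?_
  · intro x hx
    obtain ⟨z, -, rfl⟩ := Finset.mem_image.mp hx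
    exact Real.exp_pos z
  · intro x hx
    obtain ⟨z, hz, rfl⟩ := Finset.mem_image.mp hx
    have h := hs z hz
    simp_rw [hid z] at h
    simpa only [mul_div_assoc] using h

end Summit.ValiantsHypothesis.ValiantsHypothesis.Theorems.LacunarySymmetroidMatrixDescartes.Pivot.LemmaW
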